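import Summits.Schanuel.Schanuel.Theorems.ZilberEacGraphExpAlgebraic
import Summits.Schanuel.Schanuel.Theorems.ZilberEacFibreBranch
import Summits.Schanuel.Schanuel.Theorems.ZilberEacFibreLabels
import Summits.Schanuel.Schanuel.Theorems.ZilberEacBranchWitness
import Summits.Schanuel.Schanuel.Theorems.ZilberEacBranchTrichotomy
import HarnessLib

/-!
# The equimodular class, XXVII: over a polynomial graph, a NON-dense surface forces the logarithm
# of EVERY simple branch of the fibre curve to be algebraic over `ℂ(z)`

HONEST FRAMING.  Cell `pub-schanuel` (Zilber's Exponential-Algebraic Closedness, case ladder;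
host summit Schanuel), seat 2, gen 24.  **`exists_algebraic_branchLog_of_not_dense`**: let
`W = {x₁ = p(x₀), Q(x₀, y₀) = 0}` with `P` irreducible and `deg p ≥ 2`, and let `θ ≠ 0` be a SIMPLE
root of the top row `T` of `Q` (rows of degree `≤ N`).  If `W` does NOT have Zariski-dense
exponential points then, with `ψ` the analytic branch at infinity through `θ` (file XXIII), for every
`z₀` beyond an explicit radius the germ at `z₀` of `Λ(z) = log(ψ(1/z)/θ)` is ALGEBRAIC over `ℂ[z]`.
Chain: labelled exponential points on the branch (file XXIV; `e^{z_m} = ψ(1/z_m)` by uniqueness),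
the witness `exp(p(z_m)) = exp(P̃(τ + 2πi(k₀+m)))·w(1/z_m)` (file XXV), the trichotomy (file XXVI)
— so non-density leaves only a RELATION `H(1/u, w(u)) = 0`, and the algebraic core (file XXII) turns it
into algebraicity of `Λ` (its derivative `ψ'/ψ ∘ (1/z)·(-1/z²)` is algebraic as the logarithmic
derivative of an algebraic function with a simple-root non-degeneracy, and has modulus `< 1`).
File XXVIII sums these logarithms over ALL branches.  Complete classes of instances of an OPEN
question (Mantova–Masser, PLMS 2024 §1 p. 5); EC(3,2) OPEN; NOT Schanuel's conjecture (neither used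
nor implied; EAC ⇏ SC).
-/

noncomputable section

open Filter Topology Set Complex MvPolynomial
open Literature.NumberTheory.Transcendental Literature.ModelTheory.Zilber
open Literature.ModelTheory.ExponentialFields

set_option linter.dupNamespace false

namespace Summit.Schanuel.Schanuel.Theorems

/-- `‖x - 1‖ < 1/2` puts `x` in the slit plane. [folklore] -/
theorem mem_slitPlane_of_norm_sub_one_lt {x : ℂ} (hx : ‖x - 1‖ < 1 / 2) : x ∈ Complex.slitPlane := by
  rw [Complex.mem_slitPlane_iff]
  left
  have h := Complex.abs_re_le_norm (x - 1)
  rw [Complex.sub_re, Complex.one_re] at h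
  have h2 : -(1 / 2 : ℝ) < x.re - 1 := by
    have := neg_le_of_abs_le h
    linarith
  linarith

/-- **Non-density makes the logarithm of every simple branch algebraic.**  See the module
docstring. [cite: MantovaMasser2023, §1 Further remarks, p. 5 (the question, open in general)]
(new) -/
theorem exists_algebraic_branchLog_of_not_dense (Q : Polynomial (Polynomial ℂ))
    {P : MvPolynomial (Fin 2) ℂ}
    (hP : ∀ x y : ℂ, MvPolynomial.eval ![x, y] P = (Q.map (Polynomial.evalRingHom x)).eval y)
    (hirr : Irreducible P) (N : ℕ) (hN : ∀ j, (Q.coeff j).natDegree ≤ N) (T : Polynomial ℂ)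
    (hT : ∀ j, T.coeff j = (Q.coeff j).coeff N) (hT0 : T ≠ 0) {θ : ℂ} (hθ0 : θ ≠ 0)
    (hTθ : T.IsRoot θ) (hT'θ : (Polynomial.derivative T).eval θ ≠ 0)
    (p : Polynomial ℂ) (hd : 2 ≤ p.natDegree)
    (hnot : ¬ UnprojectedDense {w : Fin 2 ⊕ Fin 2 → ℂ | w (Sum.inl 1) = p.eval (w (Sum.inl 0)) ∧
      MvPolynomial.eval ![w (Sum.inl 0), w (Sum.inr 0)] P = 0}) :
    ∃ (ψ : ℂ → ℂ) (δ : ℝ), 0 < δ ∧ ψ 0 = θ ∧ AnalyticAt ℂ ψ 0 ∧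
      (∀ u : ℂ, ‖u‖ < δ → AnalyticAt ℂ ψ u ∧ ψ u ≠ 0 ∧ ψ u / θ ∈ Complex.slitPlane) ∧
      (∀ u : ℂ, ‖u‖ < δ → u ≠ 0 → (Q.map (Polynomial.evalRingHom u⁻¹)).eval (ψ u) = 0) ∧
      (∀ u y : ℂ, ‖u‖ < δ → ‖y - θ‖ < δ → u ≠ 0 →
        (Q.map (Polynomial.evalRingHom u⁻¹)).eval y = 0 → y = ψ u) ∧
      (∀ z₀ : ℂ, δ⁻¹ < ‖z₀‖ → ∃ hL : AnalyticAt ℂ (fun z => Complex.log (ψ z⁻¹ / θ)) z₀,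
        IsAlgebraic (Algebra.adjoin ℂ ({zGerm z₀} : Set (AGerm z₀))) (AGerm.mk z₀ hL)) := by
  classical
  have hQ0 : Q ≠ 0 := by
    intro hQ
    apply hT0
    ext j
    rw [hT, hQ, Polynomial.coeff_zero, Polynomial.coeff_zero, Polynomial.coeff_zero]
  -- the branch
  obtain ⟨ψ, δ₁, hδ₁, hψ0, hψan, hψball, hψroot, hψuniq⟩ :=
    exists_fibreBranch Q N hN T hT hθ0 hTθ hT'θ
  -- the witness along the datum `r = ψ/θ`
  set τ : ℂ := Complex.log θ with hτdef
  have hτ : Complex.exp τ = θ := Complex.exp_log hθ0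
  set r : ℂ → ℂ := fun u => ψ u / θ with hr
  have hr_an : AnalyticAt ℂ r 0 := hψan.div_const
  have hr0 : r 0 = 1 := by rw [hr]; simp [hψ0, div_self hθ0]
  obtain ⟨Pt, w, δ₂, hPtdeg, -, -, hw, hw0, hδ₂, -, hK1, hK2⟩ :=
    exists_branch_witness τ hτ hr_an hr0 p hd
  -- non-density leaves a relation for `w`
  have hrel : ∃ H : Polynomial (Polynomial ℂ), H ≠ 0 ∧
      ∀ᶠ u in 𝓝[≠] (0 : ℂ), (H.map (Polynomial.evalRingHom u⁻¹)).eval (w u) = 0 := by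
    by_contra htr'
    have htr : ∀ H : Polynomial (Polynomial ℂ), H ≠ 0 →
        ¬ (∀ᶠ u in 𝓝[≠] (0 : ℂ), (H.map (Polynomial.evalRingHom u⁻¹)).eval (w u) = 0) :=
      fun H hH0 hH => htr' ⟨H, hH0, hH⟩
    -- labelled exponential points on the branch
    set ε : ℝ := min 1 (δ₁ / (2 * ‖θ‖ + 1)) with hε
    have hε0 : 0 < ε := by positivity
    have hε1 : ε ≤ 1 := min_le_left _ _
    have hεδ : 2 * ‖θ‖ * ε < δ₁ := by
      have h1 : ε ≤ δ₁ / (2 * ‖θ‖ + 1) := min_le_right _ _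
      have h2 : 2 * ‖θ‖ * (δ₁ / (2 * ‖θ‖ + 1)) < δ₁ := by
        rw [mul_div_assoc']
        rw [div_lt_iff₀ (by positivity)]
        nlinarith [norm_nonneg θ]
      nlinarith [norm_nonneg θ]
    set R : ℝ := max δ₁⁻¹ δ₂⁻¹ with hR
    obtain ⟨k₀, z, hzlab, hzeq, hzR, hznorm, hzup⟩ :=
      exists_fibre_labelled_expPoints Q N hN T hT hT0 hθ0 hTθ τ hτ hε0 hε1 R
    have hzinv : ∀ m, z m ≠ 0 ∧ ‖(z m)⁻¹‖ < δ₁ := by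
      intro m
      have h1 : δ₁⁻¹ < ‖z m‖ := lt_of_le_of_lt (le_max_left _ _) (hzR m)
      have hzpos : 0 < ‖z m‖ := lt_trans (by positivity) h1
      refine ⟨norm_pos_iff.1 hzpos, ?_⟩
      rw [norm_inv]
      calc ‖z m‖⁻¹ < (δ₁⁻¹)⁻¹ := (inv_lt_inv₀ hzpos (by positivity)).2 h1
        _ = δ₁ := inv_inv δ₁
    -- `e^{z_m} = ψ(1/z_m)` by uniqueness
    have hexpψ : ∀ m, Complex.exp (z m) = ψ (z m)⁻¹ := by
      intro m
      obtain ⟨hz0, hzu⟩ := hzinv m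
      refine hψuniq (z m)⁻¹ (Complex.exp (z m)) hzu ?_ (inv_ne_zero hz0) (by rw [inv_inv]; exact hzeq m)
      have hlab : ‖z m - τ - (((k₀ + m : ℕ) : ℤ) : ℂ) * (2 * Real.pi * I)‖ < ε := by
        have := hzlab m; push_cast at this ⊢; exact this
      exact lt_of_le_of_lt (norm_exp_sub_le_of_label hτ hε1 hlab) hεδ
    -- the exact identity with label `k₀ + m`
    have hid₀ : ∀ m, Complex.exp (p.eval (z m)) =
        Complex.exp (Pt.eval (τ + (((k₀ + m : ℕ) : ℤ) : ℂ) * (2 * Real.pi * I))) * w (z m)⁻¹ := by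
      intro m
      have h2 : δ₂⁻¹ < ‖z m‖ := lt_of_le_of_lt (le_max_right _ _) (hzR m)
      have hexp : Complex.exp (z m) = θ * r (z m)⁻¹ := by
        rw [hexpψ m, hr]; simp only; rw [mul_div_cancel₀ _ hθ0]
      obtain ⟨k, hklab, hk⟩ := hK2 (z m) h2 hexp
      have hkk : k = ((k₀ + m : ℕ) : ℤ) :=
        int_eq_of_norm_sub_lt hklab (by
          have := (hzlab m).trans_le hε1; push_cast at this ⊢; exact this)
      rw [hk, hkk]
    exact hnot (unprojectedDense_of_branch_witness Q hP hirr p τ Pt hw hw0 htr k₀ z hzeq hznorm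
      hzup hid₀)
  obtain ⟨H, hH0, hH⟩ := hrel
  obtain ⟨δ₃, hδ₃, hball₃⟩ := Metric.eventually_nhds_iff.1 (eventually_nhdsWithin_iff.1 hH)
  -- the final radius
  set δ : ℝ := min δ₁ (min δ₂ δ₃) with hδ
  have hδ0 : 0 < δ := by positivity
  have hδle₁ : δ ≤ δ₁ := min_le_left _ _
  have hδle₂ : δ ≤ δ₂ := (min_le_right _ _).trans (min_le_left _ _)
  have hδle₃ : δ ≤ δ₃ := (min_le_right _ _).trans (min_le_right _ _)
  refine ⟨ψ, δ, hδ0, hψ0, hψan, fun u hu => ?_, fun u hu hu0 => hψroot u (hu.trans_le hδle₁) hu0,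
    fun u y hu hy hu0 hQy => hψuniq u y (hu.trans_le hδle₁) (hy.trans_le hδle₁) hu0 hQy,
    fun z₀ hz₀ => ?_⟩
  · obtain ⟨han, hne, hclose, -, -⟩ := hψball u (hu.trans_le hδle₁)
    exact ⟨han, hne, mem_slitPlane_of_norm_sub_one_lt hclose⟩
  -- algebraicity of the logarithm at a large point `z₀`
  have hzinv : ∀ z : ℂ, δ⁻¹ < ‖z‖ → z ≠ 0 ∧ ‖z⁻¹‖ < δ := by
    intro z hz
    have hzpos : 0 < ‖z‖ := lt_trans (by positivity) hz
    refine ⟨norm_pos_iff.1 hzpos, ?_⟩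
    rw [norm_inv]
    calc ‖z‖⁻¹ < (δ⁻¹)⁻¹ := (inv_lt_inv₀ hzpos (by positivity)).2 hz
      _ = δ := inv_inv δ
  -- facts valid at every large `z`
  have hgood : ∀ z : ℂ, δ⁻¹ < ‖z‖ → z ≠ 0 ∧ AnalyticAt ℂ ψ z⁻¹ ∧ ψ z⁻¹ ≠ 0 ∧
      ψ z⁻¹ / θ ∈ Complex.slitPlane ∧ ‖deriv ψ z⁻¹ * z⁻¹ ^ 2 / ψ z⁻¹‖ < 1 ∧
      ((weightDeg Q).map (Polynomial.evalRingHom z)).eval (ψ z⁻¹) ≠ 0 ∧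
      (Q.map (Polynomial.evalRingHom z)).eval (ψ z⁻¹) = 0 ∧
      (H.map (Polynomial.evalRingHom z)).eval (w z⁻¹) = 0 := by
    intro z hz
    obtain ⟨hz0, hzu⟩ := hzinv z hz
    obtain ⟨han, hne, hclose, hld, hW⟩ := hψball z⁻¹ (hzu.trans_le hδle₁)
    have hroot := hψroot z⁻¹ (hzu.trans_le hδle₁) (inv_ne_zero hz0)
    rw [inv_inv] at hroot
    have hW' := hW (inv_ne_zero hz0)
    rw [inv_inv] at hW'
    have hHz : (H.map (Polynomial.evalRingHom z)).eval (w z⁻¹) = 0 := by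
      have h := @hball₃ z⁻¹ (by rw [dist_zero_right]; exact hzu.trans_le hδle₃)
        (by simpa using hz0)
      rwa [inv_inv] at h
    exact ⟨hz0, han, hne, mem_slitPlane_of_norm_sub_one_lt hclose, hld, hW', hroot, hHz⟩
  obtain ⟨hz₀0, hanz₀, hnez₀, hslitz₀, hldz₀, hWz₀, -, -⟩ := hgood z₀ hz₀
  have hnear : ∀ᶠ z in 𝓝 z₀, δ⁻¹ < ‖z‖ :=
    (continuous_norm.continuousAt (x := z₀)).eventually (lt_mem_nhds hz₀)
  -- the branch `ρ(z) = ψ(1/z)`, its logarithm and logarithmic derivative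
  set ρ : ℂ → ℂ := fun z => ψ z⁻¹ with hρ
  have hρan : ∀ z : ℂ, δ⁻¹ < ‖z‖ → AnalyticAt ℂ ρ z := fun z hz =>
    (hgood z hz).2.1.comp (analyticAt_inv (hgood z hz).1)
  have hρan₀ : AnalyticAt ℂ ρ z₀ := hρan z₀ hz₀
  set g : ℂ → ℂ := fun z => deriv ρ z / ρ z with hg
  have hgan : AnalyticAt ℂ g z₀ := hρan₀.deriv.div hρan₀ hnez₀
  set L : ℂ → ℂ := fun z => Complex.log (ψ z⁻¹ / θ) with hL
  have hLan : AnalyticAt ℂ L z₀ := hρan₀.div_const.clog hslitz₀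
  have hρderiv : ∀ᶠ z in 𝓝 z₀, HasDerivAt ρ (ρ z * g z) z := by
    filter_upwards [hnear] with z hz
    have h := (hρan z hz).differentiableAt.hasDerivAt
    refine h.congr_deriv ?_
    rw [hg]
    simp only
    rw [mul_div_cancel₀ _ (hgood z hz).2.2.1]
  have hLderiv : ∀ᶠ z in 𝓝 z₀, HasDerivAt L (g z) z := by
    filter_upwards [hnear] with z hz
    obtain ⟨-, -, hne, hslit, -⟩ := hgood z hz
    have h := ((hρan z hz).differentiableAt.hasDerivAt.div_const θ).clog hslit
    refine h.congr_deriv ?_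
    rw [hg]
    change deriv ρ z / θ / (ρ z / θ) = deriv ρ z / ρ z
    field_simp
  -- `g` is algebraic (logarithmic derivative of the algebraic `ρ`, simple root) and `g(z₀) ≠ 1`
  have hQrel : ∀ᶠ z in 𝓝 z₀, (Q.map (Polynomial.evalRingHom z)).eval (ρ z) = 0 := by
    filter_upwards [hnear] with z hz using (hgood z hz).2.2.2.2.2.2.1
  have hgalg := isAlgebraic_logDeriv_of_relation hρan₀ hgan hρderiv hQ0 hQrel hWz₀
  have hg1 : g z₀ ≠ 1 := by
    have hderiv : deriv ρ z₀ = deriv ψ z₀⁻¹ * (-(z₀ ^ 2)⁻¹) := by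
      have h := (hanz₀.differentiableAt.hasDerivAt).comp z₀ (hasDerivAt_inv hz₀0)
      exact h.deriv
    intro h1
    have hval : g z₀ = -(deriv ψ z₀⁻¹ * z₀⁻¹ ^ 2 / ψ z₀⁻¹) := by
      rw [hg]
      simp only [hρ]
      rw [hderiv, inv_pow]
      ring
    rw [hval] at h1
    have := hldz₀
    rw [← norm_neg, h1, norm_one] at this
    exact lt_irrefl _ this
  -- the relation for `exp(p(z) - P̃(z - L z))` near `z₀`
  have hHw : ∀ᶠ z in 𝓝 z₀, (H.map (Polynomial.evalRingHom z)).eval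
      (Complex.exp (p.eval z - Pt.eval (z - L z))) = 0 := by
    filter_upwards [hnear] with z hz
    obtain ⟨hz0, -, -, -, -, -, -, hHz⟩ := hgood z hz
    rw [hK1 z hz0] at hHz
    exact hHz
  have hPt2 : 2 ≤ Pt.natDegree := by rw [hPtdeg]; exact hd
  exact ⟨hLan, isAlgebraic_log_of_graphExp_relation hLan hgan hLderiv hgalg hg1 p Pt hPt2 hH0 hHw⟩

end Summit.Schanuel.Schanuel.Theorems
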